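import Summits.CriticalPhenomena.PercolationContinuityZ3.Theorems.PercNearOneGluingNoHeavyLowerTailSahiThreeChainsBridgeKernel
import Literature.Combinatorics.Sahi2008.PushForward

/-!
# `NoHeavyLowerTail` (crux stmt-CriticalPhenomena-4575), Sahi programme (prim-master-conj gen 40): corollaries of the three-chains theorem

Support file (`--supports stmt-CriticalPhenomena-4575`; computational through `…SahiThreeChainsBridgeKernel`).

* `sahiPositive_three_prodWeight₃_linearOrder` — Sahi positivity of order `3` for the product of probability weights on the product of ANY
  three finite nonempty linear orders (relabelling by order isomorphisms with `Fin (k+1)`, `SahiPositive.of_pushWeight`), as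
  `ProductChains.sahiPositive_prodWeight_linearOrder` does in dimension two;
* `sahiE_three_nonneg_of_pushWeight_eq_prod₃` — factor-through form: any weight whose push-forward along `G` is a product of three chain
  weights satisfies `E₃(f∘G,g∘G,h∘G) ≥ 0` (`sahiE_pushWeight`); the 'three-block cube events' instance of Kahn's `C₃`.
-/

namespace Summit.CriticalPhenomena.PercolationContinuityZ3.Theorems.SahiThreeChains

open Finset Literature.Combinatorics.Sahi2008

/-- **Sahi's `E₃ ≥ 0` on the product of any three finite nonempty chains** `α × β × γ` (linear orders), for any three probability
weights. [this work] -/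
theorem sahiPositive_three_prodWeight₃_linearOrder {α β γ : Type*} [LinearOrder α] [Fintype α] [Nonempty α]
    [LinearOrder β] [Fintype β] [Nonempty β] [LinearOrder γ] [Fintype γ] [Nonempty γ]
    (w₁ : α → ℝ) (w₂ : β → ℝ) (w₃ : γ → ℝ) (h₁0 : ∀ x, 0 ≤ w₁ x) (h₁1 : ∑ x, w₁ x = 1) (h₂0 : ∀ y, 0 ≤ w₂ y)
    (h₂1 : ∑ y, w₂ y = 1) (h₃0 : ∀ z, 0 ≤ w₃ z) (h₃1 : ∑ z, w₃ z = 1) :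
    SahiPositive (fun p : α × β × γ => w₁ p.1 * w₂ p.2.1 * w₃ p.2.2) 3 := by
  obtain ⟨a, ha⟩ : ∃ a, Fintype.card α = a + 1 := Nat.exists_eq_succ_of_ne_zero Fintype.card_ne_zero
  obtain ⟨b, hb⟩ : ∃ b, Fintype.card β = b + 1 := Nat.exists_eq_succ_of_ne_zero Fintype.card_ne_zero
  obtain ⟨c, hc⟩ : ∃ c, Fintype.card γ = c + 1 := Nat.exists_eq_succ_of_ne_zero Fintype.card_ne_zero
  set e₁ : Fin (a + 1) ≃o α := Fintype.orderIsoFinOfCardEq α ha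
  set e₂ : Fin (b + 1) ≃o β := Fintype.orderIsoFinOfCardEq β hb
  set e₃ : Fin (c + 1) ≃o γ := Fintype.orderIsoFinOfCardEq γ hc
  set e : Fin (a + 1) × Fin (b + 1) × Fin (c + 1) ≃ α × β × γ :=
    e₁.toEquiv.prodCongr (e₂.toEquiv.prodCongr e₃.toEquiv) with he
  have hmono : Monotone e := fun p q hpq => ⟨e₁.monotone hpq.1, e₂.monotone hpq.2.1, e₃.monotone hpq.2.2⟩
  have hw : pushWeight (fun p : Fin (a + 1) × Fin (b + 1) × Fin (c + 1) => w₁ (e₁ p.1) * w₂ (e₂ p.2.1) * w₃ (e₃ p.2.2)) e =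
      fun p : α × β × γ => w₁ p.1 * w₂ p.2.1 * w₃ p.2.2 := by
    funext p
    rw [pushWeight_equiv]
    simp [he]
  rw [← hw]
  refine SahiPositive.of_pushWeight ?_ hmono
  have h₁1' : ∑ i, w₁ (e₁ i) = 1 := by rw [← h₁1]; exact e₁.toEquiv.sum_comp w₁
  have h₂1' : ∑ j, w₂ (e₂ j) = 1 := by rw [← h₂1]; exact e₂.toEquiv.sum_comp w₂
  have h₃1' : ∑ k, w₃ (e₃ k) = 1 := by rw [← h₃1]; exact e₃.toEquiv.sum_comp w₃
  exact sahiPositive_three_prodWeight₃' (fun i => w₁ (e₁ i)) (fun j => w₂ (e₂ j)) (fun k => w₃ (e₃ k)) (fun i => h₁0 _)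
    (fun j => h₂0 _) (fun k => h₃0 _) h₁1' h₂1' h₃1'

/-- **Factor-through corollary** (e.g. 'three-block' events of a cube): if a weight `w` on any finite type `β` pushes forward along
`G : β → Fin m₁ × Fin m₂ × Fin m₃` to a product of three probability weights, then `E₃^w(f∘G, g∘G, h∘G) ≥ 0` for all nonnegative monotone
`f, g, h` on the chain product (no monotonicity of `G` is needed in this direction).  For `β = {0,1}ⁿ` with a product measure and
`G = (φ₁(ω|I₁), φ₂(ω|I₂), φ₃(ω|I₃))` for disjoint coordinate blocks this is Kahn's `C₃` for events measurable w.r.t. three block statistics. [this work] -/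
theorem sahiE_three_nonneg_of_pushWeight_eq_prod₃ {β : Type*} [Fintype β] {m₁ m₂ m₃ : ℕ} (w : β → ℝ)
    (G : β → Fin m₁ × Fin m₂ × Fin m₃) (w₁ : Fin m₁ → ℝ) (w₂ : Fin m₂ → ℝ) (w₃ : Fin m₃ → ℝ) (h₁ : ∀ x, 0 ≤ w₁ x)
    (h₂ : ∀ y, 0 ≤ w₂ y) (h₃ : ∀ z, 0 ≤ w₃ z) (hw₁ : ∑ x, w₁ x = 1) (hw₂ : ∑ y, w₂ y = 1) (hw₃ : ∑ z, w₃ z = 1)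
    (hG : pushWeight w G = fun p : Fin m₁ × Fin m₂ × Fin m₃ => w₁ p.1 * w₂ p.2.1 * w₃ p.2.2)
    (f : Fin 3 → Fin m₁ × Fin m₂ × Fin m₃ → ℝ) (hf : ∀ i x, 0 ≤ f i x) (hmono : ∀ i, Monotone (f i)) :
    0 ≤ sahiE w 3 (fun i => f i ∘ G) := by
  rw [← sahiE_pushWeight, hG]
  exact sahiPositive_three_prodWeight₃' w₁ w₂ w₃ h₁ h₂ h₃ hw₁ hw₂ hw₃ f hf hmono

end Summit.CriticalPhenomena.PercolationContinuityZ3.Theorems.SahiThreeChains
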